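import Literature.MathematicalPhysics.QuantumLattice.TIDensityPhaseCoexistenceGrandCanonicalPeriodic
import Literature.MathematicalPhysics.QuantumLattice.HubbardTTPrimeGrandCanonicalGroundStateDictionary
import HarnessLib

/-!
# Thermodynamic stability on the chemical-potential axis at the level of STATES: the density of grand-canonical ground / equilibrium
# states is NON-DECREASING in `μ` (model-free), and a state carried by two chemical potentials PINS the density of every equilibrium
# state in between (incompressible plateau; the Mott plateau of the `t–t'` model at the state level)

Topic `Literature/MathematicalPhysics/QuantumLattice` (family `hubbard`; cell `pub/hubbard-downfold`, MO-S1 ↔ S2 seam «box ↦ one word», filling direction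
= the Legendre pair `μ ↔ n`; written 2026-08-28 by hubbard-downfold-unc-2 g23). Companion of `HubbardTTPrimeGrandCanonicalEquilibriumStateDictionary`
(the supporting set `M_β(n)` of a density is a compact interval; the chemical potentials carrying a state are exactly that interval) and of
`TIDensityPhaseCoexistenceGrandCanonical` (certified `Δμ` gaps). Two elementary consequences of the variational characterisations, for ANY
interaction `Ψ` on `ℤ^d` and any `μ`-shifts `Γ₁, Γ₂` of `Ψ` (`e_{Γᵢ} = e_Ψ − μᵢρ`), with two-line proofs (add the two minimiser / maximiser
inequalities of the pair of states against each other):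

* §1 `T = 0`: `IsMeanEnergyMinimiser.mul_sub_chemPot_mul_sub_density_nonneg` — ground states `ω₁` at `μ₁`, `ω₂` at `μ₂` obey
  `(μ₂ − μ₁)(ρ(ω₂) − ρ(ω₁)) ≥ 0`; hence `μ₁ < μ₂ ⇒ ρ(ω₁) ≤ ρ(ω₂)` and `ρ(ω₁) < ρ(ω₂) ⇒ μ₁ ≤ μ₂`; the PLATEAU: if ONE state is a ground state at
  `μ_a` and at `μ_b > μ_a`, every ground state at any `μ ∈ (μ_a, μ_b)` has exactly its density (`IsMeanEnergyMinimiser.density_eq_of_mem_Ioo`).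
* §2 `T > 0` (`β > 0`): the same four facts for variational equilibria (`IsVarEquilibrium.…`).
* §3 the `t–t'` model: **the MOTT PLATEAU at the state level** — for `0 < n < 2` and `μ` STRICTLY inside the cell `(μ₋(n), μ₊(n))`, every
  translation-invariant grand-canonical ground state of `H − μN` has density exactly `n` (`IsMeanEnergyMinimiser.density_eq_of_mem_Ioo_chemPot`; at
  `n = 1` the charge-gap statement `…density_eq_one_of_mem_Ioo_chemPot`), and so has the CELL FILLING of every superlattice-periodic grand-canonical
  ground state (`IsPeriodic.cellFilling_eq_of_mem_Ioo_chemPot`); the `T > 0` twin with the supporting cell `(sInf M_β(n), sSup M_β(n))`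
  (`IsVarEquilibrium.density_eq_of_sInf_lt_of_lt_sSup`).

HONEST SCOPE: structural; at `T > 0` the open supporting cell is expected to be EMPTY (no plateau) at generic densities — the theorem is an
implication, not a claim that plateaus exist; translation-invariant / periodic variational equilibria and mean-energy minimisers; no number, no named
fact, no definition. Everything is PROVED, 0 sorry.

## Mathlib / tree search
REUSED: `IsMeanEnergyMinimiser`, `IsVarEquilibrium`, `sub_mul_le_varPressure` (`InfVolFermionState`, `TIVariationalPressure`);
`isMeanEnergyMinimiser_of_meanEnergy_eq_of_chemPot_mem_Icc` (`HubbardTTPrimeGrandCanonicalGroundStateDictionary`); `isLeast_meanEnergy_energyDensityTT'`;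
`meanEnergy_hubbardTTPrimeMu_eq_sub`; `isVarEquilibrium_gcInteractionTT'_of_sub_mul_eq_pressureTT'_of_supporting`, `supportingSet_eq_Icc`, `supportingSet_nonempty`
(`HubbardTTPrimeGrandCanonicalEquilibriumStateDictionary`); `exists_isTorusLimitOfMixture_sectorGibbs`, `IsTorusLimitOfMixture.density_eq_of_sectorGibbs`,
`…entropyDensitySup_sub_mul_eq_pressureTT'_of_sectorGibbs`; `IsPeriodic.isMeanEnergyMinimiser_cellAverage`, `cellFilling_eq_density_cellAverage`
(`TIDensityPhaseCoexistenceGrandCanonicalPeriodic`). `lean search 'Minimiser.*density_le_density|VarEquilibrium.*density.*mono|plateau|density_eq_one_of'`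
(2026-08-28): function-level monotonicity only (`gcPressureTT'_mono`, `convexOn_gcPressureTT'`, density brackets).

## References
* D. Ruelle, *Statistical Mechanics: Rigorous Results* (1969), §3.4 (thermodynamic stability, `∂ρ/∂μ ≥ 0`). [cite: Ruelle1969, §3.4]
* R. B. Israel, *Convexity in the Theory of Lattice Gases* (1979), Thm. I.2.4. [cite: Israel1979, Thm. I.2.4]
* E. H. Lieb, F. Y. Wu, Physica A 321 (2003) 1, §7 (`μ±`, the Mott gap). [cite: LiebWuPhysicaA2003, §7]
* R. T. Rockafellar, *Convex Analysis* (1970), Thm. 24.1. [cite: Rockafellar1970, Thm. 24.1]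
-/

noncomputable section

open scoped ComplexOrder BigOperators

namespace Literature.MathematicalPhysics.QuantumLattice

open Matrix HubbardWave0 Literature.Probability.LatticeModels ThermodynamicLimit InfVolFermionState FermionInteraction Set
open _root_.Filter

namespace InfVolFermionState

/-! ## §1 `T = 0`, model-free -/

section GroundStates

variable {d : ℕ} (Ψ : FermionInteraction d) (R : ℝ) {Γ Γ₁ Γ₂ : FermionInteraction d} {R' R₁ R₂ μ μ₁ μ₂ : ℝ}
  {ω ω₁ ω₂ : InfVolFermionState d}

/-- **Thermodynamic stability at `T = 0` (model-free).** Translation-invariant ground states `ω₁` of `H − μ₁N` and `ω₂` of `H − μ₂N` (any `μ`-shifts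
`Γ₁, Γ₂` of `Ψ`) obey `(μ₂ − μ₁)(ρ(ω₂) − ρ(ω₁)) ≥ 0` — add `e_{Γ₁}(ω₁) ≤ e_{Γ₁}(ω₂)` and `e_{Γ₂}(ω₂) ≤ e_{Γ₂}(ω₁)`. [cite: Ruelle1969, §3.4] -/
theorem IsMeanEnergyMinimiser.mul_sub_chemPot_mul_sub_density_nonneg (h₁ : ω₁.IsMeanEnergyMinimiser Γ₁ R₁)
    (hΓ₁ : ∀ σ : InfVolFermionState d, σ.meanEnergy Γ₁ R₁ = σ.meanEnergy Ψ R - μ₁ * σ.density)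
    (h₂ : ω₂.IsMeanEnergyMinimiser Γ₂ R₂)
    (hΓ₂ : ∀ σ : InfVolFermionState d, σ.meanEnergy Γ₂ R₂ = σ.meanEnergy Ψ R - μ₂ * σ.density) :
    0 ≤ (μ₂ - μ₁) * (ω₂.density - ω₁.density) := by
  have k1 := h₁.2 ω₂ h₂.1
  have k2 := h₂.2 ω₁ h₁.1
  rw [hΓ₁, hΓ₁] at k1
  rw [hΓ₂, hΓ₂] at k2
  nlinarith [k1, k2]

/-- **The density is non-decreasing in `μ` across ground states**: `μ₁ < μ₂ ⇒ ρ(ω₁) ≤ ρ(ω₂)`. [cite: Ruelle1969, §3.4] -/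
theorem IsMeanEnergyMinimiser.density_le_density_of_chemPot_lt (h₁ : ω₁.IsMeanEnergyMinimiser Γ₁ R₁)
    (hΓ₁ : ∀ σ : InfVolFermionState d, σ.meanEnergy Γ₁ R₁ = σ.meanEnergy Ψ R - μ₁ * σ.density)
    (h₂ : ω₂.IsMeanEnergyMinimiser Γ₂ R₂)
    (hΓ₂ : ∀ σ : InfVolFermionState d, σ.meanEnergy Γ₂ R₂ = σ.meanEnergy Ψ R - μ₂ * σ.density) (hμ : μ₁ < μ₂) :
    ω₁.density ≤ ω₂.density := by
  have h := h₁.mul_sub_chemPot_mul_sub_density_nonneg Ψ R hΓ₁ h₂ hΓ₂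
  by_contra hlt
  have : (μ₂ - μ₁) * (ω₂.density - ω₁.density) < 0 := mul_neg_of_pos_of_neg (sub_pos.2 hμ) (by linarith [not_le.1 hlt])
  linarith

/-- **The chemical potential is non-decreasing in the density across ground states**: `ρ(ω₁) < ρ(ω₂) ⇒ μ₁ ≤ μ₂`. [cite: Ruelle1969, §3.4] -/
theorem IsMeanEnergyMinimiser.chemPot_le_chemPot_of_density_lt (h₁ : ω₁.IsMeanEnergyMinimiser Γ₁ R₁)
    (hΓ₁ : ∀ σ : InfVolFermionState d, σ.meanEnergy Γ₁ R₁ = σ.meanEnergy Ψ R - μ₁ * σ.density)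
    (h₂ : ω₂.IsMeanEnergyMinimiser Γ₂ R₂)
    (hΓ₂ : ∀ σ : InfVolFermionState d, σ.meanEnergy Γ₂ R₂ = σ.meanEnergy Ψ R - μ₂ * σ.density) (hρ : ω₁.density < ω₂.density) :
    μ₁ ≤ μ₂ := by
  have h := h₁.mul_sub_chemPot_mul_sub_density_nonneg Ψ R hΓ₁ h₂ hΓ₂
  by_contra hlt
  have : (μ₂ - μ₁) * (ω₂.density - ω₁.density) < 0 := mul_neg_of_neg_of_pos (by linarith [not_le.1 hlt]) (sub_pos.2 hρ)
  linarith

variable {Γa Γb : FermionInteraction d} {Ra Rb μa μb : ℝ} {ωa : InfVolFermionState d}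

/-- **INCOMPRESSIBLE PLATEAU (`T = 0`, model-free).** If ONE translation-invariant state `ωa` is a ground state of `H − μ_aN` AND of `H − μ_bN` with
`μ_a < μ_b` (its density's subgradient cell contains `[μ_a, μ_b]`), then every translation-invariant ground state `ω` of `H − μN` at any
`μ ∈ (μ_a, μ_b)` has density EXACTLY `ρ(ωa)`. [cite: LiebWuPhysicaA2003, §7] [cite: Ruelle1969, §3.4] -/
theorem IsMeanEnergyMinimiser.density_eq_of_mem_Ioo (ha : ωa.IsMeanEnergyMinimiser Γa Ra)
    (hΓa : ∀ σ : InfVolFermionState d, σ.meanEnergy Γa Ra = σ.meanEnergy Ψ R - μa * σ.density)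
    (hb : ωa.IsMeanEnergyMinimiser Γb Rb)
    (hΓb : ∀ σ : InfVolFermionState d, σ.meanEnergy Γb Rb = σ.meanEnergy Ψ R - μb * σ.density)
    (hω : ω.IsMeanEnergyMinimiser Γ R')
    (hΓ : ∀ σ : InfVolFermionState d, σ.meanEnergy Γ R' = σ.meanEnergy Ψ R - μ * σ.density) (hμ : μ ∈ Ioo μa μb) :
    ω.density = ωa.density :=
  le_antisymm (hω.density_le_density_of_chemPot_lt Ψ R hΓ hb hΓb hμ.2) (ha.density_le_density_of_chemPot_lt Ψ R hΓa hω hΓ hμ.1)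

end GroundStates

/-! ## §2 `T > 0`, model-free -/

section Equilibria

variable {d : ℕ} (β : ℝ) (Ψ : FermionInteraction d) (R : ℝ) {Γ Γ₁ Γ₂ : FermionInteraction d} {R' R₁ R₂ μ μ₁ μ₂ : ℝ}
  {ω ω₁ ω₂ : InfVolFermionState d}

/-- **Thermodynamic stability at `T > 0` (model-free).** Variational equilibria `ω₁` of `H − μ₁N` and `ω₂` of `H − μ₂N` at the same `β` obey
`β(μ₂ − μ₁)(ρ(ω₂) − ρ(ω₁)) ≥ 0` — add the two maximiser inequalities of the pair against each other. [cite: Ruelle1969, §3.4] [cite: Israel1979, Thm. I.2.4] -/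
theorem IsVarEquilibrium.mul_mul_sub_chemPot_mul_sub_density_nonneg (h₁ : ω₁.IsVarEquilibrium β Γ₁ R₁)
    (hΓ₁ : ∀ σ : InfVolFermionState d, σ.meanEnergy Γ₁ R₁ = σ.meanEnergy Ψ R - μ₁ * σ.density)
    (h₂ : ω₂.IsVarEquilibrium β Γ₂ R₂)
    (hΓ₂ : ∀ σ : InfVolFermionState d, σ.meanEnergy Γ₂ R₂ = σ.meanEnergy Ψ R - μ₂ * σ.density) :
    0 ≤ β * ((μ₂ - μ₁) * (ω₂.density - ω₁.density)) := by
  have k1 := Γ₁.sub_mul_le_varPressure β R₁ h₂.1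
  have k2 := Γ₂.sub_mul_le_varPressure β R₂ h₁.1
  rw [← h₁.2, hΓ₁, hΓ₁] at k1
  rw [← h₂.2, hΓ₂, hΓ₂] at k2
  nlinarith [k1, k2]

/-- **The density is non-decreasing in `μ` across equilibrium states** (`β > 0`): `μ₁ < μ₂ ⇒ ρ(ω₁) ≤ ρ(ω₂)`. [cite: Ruelle1969, §3.4] -/
theorem IsVarEquilibrium.density_le_density_of_chemPot_lt (hβ : 0 < β) (h₁ : ω₁.IsVarEquilibrium β Γ₁ R₁)
    (hΓ₁ : ∀ σ : InfVolFermionState d, σ.meanEnergy Γ₁ R₁ = σ.meanEnergy Ψ R - μ₁ * σ.density)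
    (h₂ : ω₂.IsVarEquilibrium β Γ₂ R₂)
    (hΓ₂ : ∀ σ : InfVolFermionState d, σ.meanEnergy Γ₂ R₂ = σ.meanEnergy Ψ R - μ₂ * σ.density) (hμ : μ₁ < μ₂) :
    ω₁.density ≤ ω₂.density := by
  have h := h₁.mul_mul_sub_chemPot_mul_sub_density_nonneg β Ψ R hΓ₁ h₂ hΓ₂
  by_contra hlt
  have : (μ₂ - μ₁) * (ω₂.density - ω₁.density) < 0 := mul_neg_of_pos_of_neg (sub_pos.2 hμ) (by linarith [not_le.1 hlt])
  nlinarith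

/-- **The chemical potential is non-decreasing in the density across equilibrium states** (`β > 0`): `ρ(ω₁) < ρ(ω₂) ⇒ μ₁ ≤ μ₂`. [cite: Ruelle1969, §3.4] -/
theorem IsVarEquilibrium.chemPot_le_chemPot_of_density_lt (hβ : 0 < β) (h₁ : ω₁.IsVarEquilibrium β Γ₁ R₁)
    (hΓ₁ : ∀ σ : InfVolFermionState d, σ.meanEnergy Γ₁ R₁ = σ.meanEnergy Ψ R - μ₁ * σ.density)
    (h₂ : ω₂.IsVarEquilibrium β Γ₂ R₂)
    (hΓ₂ : ∀ σ : InfVolFermionState d, σ.meanEnergy Γ₂ R₂ = σ.meanEnergy Ψ R - μ₂ * σ.density) (hρ : ω₁.density < ω₂.density) :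
    μ₁ ≤ μ₂ := by
  have h := h₁.mul_mul_sub_chemPot_mul_sub_density_nonneg β Ψ R hΓ₁ h₂ hΓ₂
  by_contra hlt
  have : (μ₂ - μ₁) * (ω₂.density - ω₁.density) < 0 := mul_neg_of_neg_of_pos (by linarith [not_le.1 hlt]) (sub_pos.2 hρ)
  nlinarith

variable {Γa Γb : FermionInteraction d} {Ra Rb μa μb : ℝ} {ωa : InfVolFermionState d}

/-- **INCOMPRESSIBLE PLATEAU (`T > 0`, model-free, `β > 0`).** If one translation-invariant state `ωa` is an equilibrium of `H − μ_aN` and of `H − μ_bN`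
at `β` with `μ_a < μ_b`, then every equilibrium `ω` of `H − μN` at `β` with `μ ∈ (μ_a, μ_b)` has density exactly `ρ(ωa)`.
[cite: Ruelle1969, §3.4] [cite: Israel1979, Thm. I.2.4] -/
theorem IsVarEquilibrium.density_eq_of_mem_Ioo (hβ : 0 < β) (ha : ωa.IsVarEquilibrium β Γa Ra)
    (hΓa : ∀ σ : InfVolFermionState d, σ.meanEnergy Γa Ra = σ.meanEnergy Ψ R - μa * σ.density)
    (hb : ωa.IsVarEquilibrium β Γb Rb)
    (hΓb : ∀ σ : InfVolFermionState d, σ.meanEnergy Γb Rb = σ.meanEnergy Ψ R - μb * σ.density)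
    (hω : ω.IsVarEquilibrium β Γ R')
    (hΓ : ∀ σ : InfVolFermionState d, σ.meanEnergy Γ R' = σ.meanEnergy Ψ R - μ * σ.density) (hμ : μ ∈ Ioo μa μb) :
    ω.density = ωa.density :=
  le_antisymm (hω.density_le_density_of_chemPot_lt β Ψ R hβ hΓ hb hΓb hμ.2)
    (ha.density_le_density_of_chemPot_lt β Ψ R hβ hΓa hω hΓ hμ.1)

end Equilibria

/-! ## §3 The `t–t'` model: the Mott plateau at the state level, and the `T > 0` twin -/

section TTPrime

variable (t t' : ℝ) {U : ℝ} (hU : 0 ≤ U) {Γ : FermionInteraction 2} {R' μ : ℝ} {ω : InfVolFermionState 2}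
include hU

/-- **THE STATE-LEVEL PLATEAU OF THE `μ±` CELL (`T = 0`).** For `0 < n < 2` and `μ` strictly inside `(μ₋(n), μ₊(n))`, every translation-invariant
grand-canonical ground state of `H − μN` (any `μ`-shift `Γ` of `Φ(t,t',U)`) has density EXACTLY `n`: a canonical ground state of density `n` exists and is
grand-canonical at `μ₋(n)` and at `μ₊(n)`; apply the model-free plateau. [cite: LiebWuPhysicaA2003, §7] [cite: Ruelle1969, §3.4] -/
theorem IsMeanEnergyMinimiser.density_eq_of_mem_Ioo_chemPot (hω : ω.IsMeanEnergyMinimiser Γ R')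
    (hΓ : ∀ σ : InfVolFermionState 2, σ.meanEnergy Γ R' = σ.meanEnergy (hubbardTTPrimeFermionInteraction t t' U) 1 - μ * σ.density)
    {n : ℝ} (hn0 : 0 < n) (hn2 : n < 2) (hμ : μ ∈ Ioo (chemPotMinusTT' t t' U n) (chemPotPlusTT' t t' U n)) :
    ω.density = n := by
  obtain ⟨ωn, hTI, hρ, he⟩ := (isLeast_meanEnergy_energyDensityTT' t t' hU hn0 hn2).1
  have hle : chemPotMinusTT' t t' U n ≤ chemPotPlusTT' t t' U n := (hμ.1.trans hμ.2).le
  have hρ0 : 0 < ωn.density := by rw [hρ]; exact hn0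
  have hρ2 : ωn.density < 2 := by rw [hρ]; exact hn2
  have he' : ωn.meanEnergy (hubbardTTPrimeFermionInteraction t t' U) 1 = energyDensityTT' t t' U ωn.density := by rw [hρ]; exact he
  have ha : ωn.IsMeanEnergyMinimiser (hubbardTTPrimeMuInteraction t t' U (chemPotMinusTT' t t' U n)) 1 :=
    isMeanEnergyMinimiser_of_meanEnergy_eq_of_chemPot_mem_Icc t t' hU hTI
      (meanEnergy_hubbardTTPrimeMu_eq_sub t t' U _) hρ0 hρ2 he' (by rw [hρ]; exact ⟨le_rfl, hle⟩)
  have hb : ωn.IsMeanEnergyMinimiser (hubbardTTPrimeMuInteraction t t' U (chemPotPlusTT' t t' U n)) 1 :=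
    isMeanEnergyMinimiser_of_meanEnergy_eq_of_chemPot_mem_Icc t t' hU hTI
      (meanEnergy_hubbardTTPrimeMu_eq_sub t t' U _) hρ0 hρ2 he' (by rw [hρ]; exact ⟨hle, le_rfl⟩)
  rw [← hρ]
  exact ha.density_eq_of_mem_Ioo (hubbardTTPrimeFermionInteraction t t' U) 1 (meanEnergy_hubbardTTPrimeMu_eq_sub t t' U _) hb
    (meanEnergy_hubbardTTPrimeMu_eq_sub t t' U _) hω hΓ hμ

/-- **THE MOTT PLATEAU AT THE STATE LEVEL**: for `μ` strictly inside the charge gap `(μ₋(1), μ₊(1))` every translation-invariant grand-canonical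
ground state of `H − μN` is exactly half filled. [cite: LiebWuPhysicaA2003, §7] -/
theorem IsMeanEnergyMinimiser.density_eq_one_of_mem_Ioo_chemPot (hω : ω.IsMeanEnergyMinimiser Γ R')
    (hΓ : ∀ σ : InfVolFermionState 2, σ.meanEnergy Γ R' = σ.meanEnergy (hubbardTTPrimeFermionInteraction t t' U) 1 - μ * σ.density)
    (hμ : μ ∈ Ioo (chemPotMinusTT' t t' U 1) (chemPotPlusTT' t t' U 1)) :
    ω.density = 1 :=
  hω.density_eq_of_mem_Ioo_chemPot t t' hU hΓ one_pos one_lt_two hμ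

/-- **… and for SUPERLATTICE-PERIODIC ground states (stripes, Néel states)**: a `q`-periodic state minimising the cell energy of the
translation-covariant `H − μN` among `q`-periodic states, with `μ ∈ (μ₋(n), μ₊(n))`, has CELL FILLING exactly `n`.
[cite: LiebWuPhysicaA2003, §7] [cite: BratteliRobinsonI1987, §4.3.1] -/
theorem IsPeriodic.cellFilling_eq_of_mem_Ioo_chemPot {q : Fin 2 → ℕ} (hω : ω.IsPeriodic q) (hT : Γ.IsTranslationInvariant)
    (hmin : ∀ σ : InfVolFermionState 2, σ.IsPeriodic q → cellMeanEnergy q Γ ω R' ≤ cellMeanEnergy q Γ σ R')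
    (hΓ : ∀ σ : InfVolFermionState 2, σ.meanEnergy Γ R' = σ.meanEnergy (hubbardTTPrimeFermionInteraction t t' U) 1 - μ * σ.density)
    {n : ℝ} (hn0 : 0 < n) (hn2 : n < 2) (hμ : μ ∈ Ioo (chemPotMinusTT' t t' U n) (chemPotPlusTT' t t' U n)) :
    ω.cellFilling q = n := by
  rw [cellFilling_eq_density_cellAverage]
  exact (hω.isMeanEnergyMinimiser_cellAverage hT hmin).density_eq_of_mem_Ioo_chemPot t t' hU hΓ hn0 hn2 hμ

variable {β : ℝ} (hβ : 0 < β)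
include hβ

/-- **The `T > 0` twin: a non-degenerate supporting cell pins the density.** If `0 < n < 2` and `μ` lies strictly between `sInf M_β(n)` and
`sSup M_β(n)` (`M_β(n)` the supporting set of `p(β;·)` at `n`), every translation-invariant equilibrium of `H − μN` at `β` has density exactly `n`
(a canonical equilibrium state of density `n` exists — a torus limit of sector Gibbs states — and is grand-canonical at both ends of the compact cell).
HONEST REMARK: at `T > 0` the cell is expected to be a single point, in which case the hypothesis is void. [cite: Israel1979, Thm. I.2.4] [cite: Ruelle1969, §3.4] -/
theorem IsVarEquilibrium.density_eq_of_sInf_lt_of_lt_sSup (hω : ω.IsVarEquilibrium β Γ R')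
    (hΓ : ∀ σ : InfVolFermionState 2, σ.meanEnergy Γ R' = σ.meanEnergy (hubbardTTPrimeFermionInteraction t t' U) 1 - μ * σ.density)
    {n : ℝ} (hn0 : 0 < n) (hn2 : n < 2)
    (hlo : sInf {ν : ℝ | pressureTT' β t t' U n = gcPressureTT' β t t' U ν - β * ν * n} < μ)
    (hhi : μ < sSup {ν : ℝ | pressureTT' β t t' U n = gcPressureTT' β t t' U ν - β * ν * n}) :
    ω.density = n := by
  set S := {ν : ℝ | pressureTT' β t t' U n = gcPressureTT' β t t' U ν - β * ν * n} with hS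
  -- a canonical equilibrium state of density `n`
  obtain ⟨φ, hφ, ωn, hωn⟩ := exists_isTorusLimitOfMixture_sectorGibbs β t t' U hn0.le hn2.le (Ls := fun k => k) tendsto_id
  have hLs : Tendsto ((fun k : ℕ => k) ∘ φ) atTop atTop := hφ.tendsto_atTop
  have hTI := hωn.isTranslationInvariant
  have hρ := hωn.density_eq_of_sectorGibbs t t' U hn0.le hn2.le β hLs
  have heq := hωn.entropyDensitySup_sub_mul_eq_pressureTT'_of_sectorGibbs t t' hU hβ hn0 hn2 hLs
  -- both ends of the compact cell support `p(β;·)` at `n`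
  have hIcc := ThermodynamicLimit.supportingSet_eq_Icc t t' hβ hU hn0 hn2
  have hne : (Set.Icc (sInf S) (sSup S)).Nonempty := by
    rw [← hS] at hIcc; rw [← hIcc]; exact ThermodynamicLimit.supportingSet_nonempty t t' hβ hU hn0 hn2
  have hab : sInf S ≤ sSup S := Set.nonempty_Icc.1 hne
  have ha : sInf S ∈ S := by
    have : sInf S ∈ Set.Icc (sInf S) (sSup S) := Set.left_mem_Icc.2 hab
    rw [hS, ← hIcc] at this; exact this
  have hb : sSup S ∈ S := by
    have : sSup S ∈ Set.Icc (sInf S) (sSup S) := Set.right_mem_Icc.2 hab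
    rw [hS, ← hIcc] at this; exact this
  have heq' : ωn.entropyDensitySup - β * ωn.meanEnergy (hubbardTTPrimeFermionInteraction t t' U) 1 = pressureTT' β t t' U ωn.density := by
    rw [hρ]; exact heq
  have hA := isVarEquilibrium_gcInteractionTT'_of_sub_mul_eq_pressureTT'_of_supporting t t' hU hβ hTI heq' (μ₀ := sInf S)
    (by rw [hρ]; exact ha)
  have hB := isVarEquilibrium_gcInteractionTT'_of_sub_mul_eq_pressureTT'_of_supporting t t' hU hβ hTI heq' (μ₀ := sSup S)
    (by rw [hρ]; exact hb)
  rw [← hρ]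
  exact hA.density_eq_of_mem_Ioo β (hubbardTTPrimeFermionInteraction t t' U) 1 hβ (meanEnergy_gcInteractionTT'_zero_field_eq_sub t t' U _)
    hB (meanEnergy_gcInteractionTT'_zero_field_eq_sub t t' U _) hω hΓ ⟨hlo, hhi⟩

end TTPrime

end InfVolFermionState

end Literature.MathematicalPhysics.QuantumLattice

end
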